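import Mathlib
import Summits.Ventures.PercRepro2.EightTypedTestsA
import Summits.Ventures.PercRepro2.EightTypedTestsB
import Summits.Ventures.PercRepro2.EightTypedTestsC
import Summits.Ventures.PercRepro2.EightTypedTestsD
import Summits.Ventures.PercRepro2.EightTypedTestsE
import Summits.Ventures.PercRepro2.EightTypedTestsF
import Summits.Ventures.PercRepro2.EightTypedTestsG
import Summits.Ventures.PercRepro2.EightTypedTestsH
import Summits.Ventures.PercRepro2.EightTypedTable

/-!
# Eight typed edges, III: the leaf tests of the eight groups (blind cell PercRepro2, night-3 g10, 2026-08-26)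

`okQ8G := okTab8G (states8 0 …)` — the finite statement behind row 2′TRI for eight typed edges on one labelling, per
group of `32` type vectors.
-/

namespace Summit.Ventures.PercRepro2

open UnionCluster

namespace CovForm

namespace TwoTyped

open OneTyped

section LeafQ8

/-- The cube tests of group `A` on one labelling of the twenty-one points. -/
def okQ8A (a1 a2 a3 a4 a5 a6 a7 a8 a9 a10 a11 a12 a13 a14 a15 a16 a17 a18 a19 a20 : ℕ) : Bool := okTab8A (states8 0 a1 a2 a3 a4 a5 a6 a7 a8 a9 a10 a11 a12 a13 a14 a15 a16 a17 a18 a19 a20)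

/-- The cube tests of group `B` on one labelling of the twenty-one points. -/
def okQ8B (a1 a2 a3 a4 a5 a6 a7 a8 a9 a10 a11 a12 a13 a14 a15 a16 a17 a18 a19 a20 : ℕ) : Bool := okTab8B (states8 0 a1 a2 a3 a4 a5 a6 a7 a8 a9 a10 a11 a12 a13 a14 a15 a16 a17 a18 a19 a20)

/-- The cube tests of group `C` on one labelling of the twenty-one points. -/
def okQ8C (a1 a2 a3 a4 a5 a6 a7 a8 a9 a10 a11 a12 a13 a14 a15 a16 a17 a18 a19 a20 : ℕ) : Bool := okTab8C (states8 0 a1 a2 a3 a4 a5 a6 a7 a8 a9 a10 a11 a12 a13 a14 a15 a16 a17 a18 a19 a20)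

/-- The cube tests of group `D` on one labelling of the twenty-one points. -/
def okQ8D (a1 a2 a3 a4 a5 a6 a7 a8 a9 a10 a11 a12 a13 a14 a15 a16 a17 a18 a19 a20 : ℕ) : Bool := okTab8D (states8 0 a1 a2 a3 a4 a5 a6 a7 a8 a9 a10 a11 a12 a13 a14 a15 a16 a17 a18 a19 a20)

/-- The cube tests of group `E` on one labelling of the twenty-one points. -/
def okQ8E (a1 a2 a3 a4 a5 a6 a7 a8 a9 a10 a11 a12 a13 a14 a15 a16 a17 a18 a19 a20 : ℕ) : Bool := okTab8E (states8 0 a1 a2 a3 a4 a5 a6 a7 a8 a9 a10 a11 a12 a13 a14 a15 a16 a17 a18 a19 a20)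

/-- The cube tests of group `F` on one labelling of the twenty-one points. -/
def okQ8F (a1 a2 a3 a4 a5 a6 a7 a8 a9 a10 a11 a12 a13 a14 a15 a16 a17 a18 a19 a20 : ℕ) : Bool := okTab8F (states8 0 a1 a2 a3 a4 a5 a6 a7 a8 a9 a10 a11 a12 a13 a14 a15 a16 a17 a18 a19 a20)

/-- The cube tests of group `G` on one labelling of the twenty-one points. -/
def okQ8G (a1 a2 a3 a4 a5 a6 a7 a8 a9 a10 a11 a12 a13 a14 a15 a16 a17 a18 a19 a20 : ℕ) : Bool := okTab8G (states8 0 a1 a2 a3 a4 a5 a6 a7 a8 a9 a10 a11 a12 a13 a14 a15 a16 a17 a18 a19 a20)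

/-- The cube tests of group `H` on one labelling of the twenty-one points. -/
def okQ8H (a1 a2 a3 a4 a5 a6 a7 a8 a9 a10 a11 a12 a13 a14 a15 a16 a17 a18 a19 a20 : ℕ) : Bool := okTab8H (states8 0 a1 a2 a3 a4 a5 a6 a7 a8 a9 a10 a11 a12 a13 a14 a15 a16 a17 a18 a19 a20)

end LeafQ8

end TwoTyped

end CovForm

end Summit.Ventures.PercRepro2
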